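import Literature.AnabelianGeometry.SemiGraphs.PSCGraphicConverse

/-!
# [CombGC] Proposition 1.5: the abutment clause of the incidence relations — automatic except for loops (proved)

Mochizuki, *A combinatorial version of the Grothendieck conjecture*, Tohoku Math. J. **59** (2007)
[CombGC], §1, Proposition 1.5, author's manuscript pp. 12–13.  The typed incidence relation
`PSCDatum.EdgeLikeIncidence` (`PSCGraphicity.lean`, abc-iut-L3-t4; Prop. 1.5 (i): "An edge-like subgroup
of `Π_G` is cuspidal (respectively, not cuspidal) if and only if it is contained in precisely one
(respectively, precisely two) verticial subgroup(s)") COUNTS the verticial subgroups containing an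
edge-like subgroup but does not NAME their vertices, whereas the printed proof of Prop. 1.5 (ii), p. 13,
uses "the data of which vertices an edge abuts to", supplied in print by the proof of (i), p. 13: "if `e`
is a cuspidal (respectively, nodal) edge of `G` that does not abut to a vertex `v`, then there exists a
finite étale `Π_G`-covering `G' → G` which is trivial over `G_v`, but nontrivial over `G_e`" — i.e.
`Π_e ≤ δ Π_u δ⁻¹` only if `e` abuts to `u` (the "branch link", GAP-LEDGER rows G-w4d081-1 / G-w4d110-1 of
the abc-iut cell).  [cite: MochizukiCombGC2007, Prop 1.5(i) p.13]

This PROOF-ONLY file (revision 2: the Prop. 1.5 (ii) transport lemmas of revision 1 DUPLICATED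
`PSCGraphicConverse.lean` of abc-iut-w4-d081, landed in the same gate batch, and are withdrawn here in
favour of that file, which is imported and reused — one declaration per notion) proves, over the
interface `PSCDatum Π`, that the branch link is AUTOMATIC for nodes with two distinct end vertices, given
Prop. 1.2 (i) (`VerticialOpenInterDeterminesVertex`, `EdgeLikeOpenInterDeterminesEdge`) and the counted
Prop. 1.5 (i) (`EdgeLikeIncidence`) BY NAME: the two verticial subgroups containing `Π_e` are then the
evident conjugates of `Π_{v₁}`, `Π_{v₂}` (`mem_nodeEnds_of_nodeGp_le`); hence the full branch link follows
from its LOOP case alone (`abutment_of_loops`).  Also: the conjugation-invariance and the transport along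
a group-theoretically verticial `α` of "`E` lies in a verticial subgroup arising from `u`"
(`exists_le_smul_iff_smul`, `exists_le_smul_iff_map`), and the dictionary between `nodeEnds e` and the
verticial subgroups containing `Π_e` under the branch link (`mem_nodeEnds_iff_exists_nodeGp_le_smul`).
No definitions; nothing here takes a side on [IUTchIII] Cor. 3.12; the inputs remain named hypotheses
(FACT-policy items of [CombGC]); typed ≠ proved for them.
-/

noncomputable section

namespace Literature.AnabelianGeometry.SemiGraphs

namespace PSCDatum

open scoped Pointwise

universe u

variable {P : Type u} [Group P] [TopologicalSpace P]
variable {P' : Type u} [Group P'] [TopologicalSpace P']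

section Abutment

variable {G : PSCDatum P} {H : PSCDatum P'} {α : P ≃ₜ* P'}

/-- Transport of "`E` lies in a verticial subgroup arising from `u`" along `α`, given that `α` carries
the class of `Π_u` to the class of `Π_w`: `E ≤ δ Π_u δ⁻¹` for some `δ` iff `α(E) ≤ δ' Π_w δ'⁻¹` for some
`δ'`. [cite: MochizukiCombGC2007, Prop 1.5(ii) p.13] -/
theorem exists_le_smul_iff_map {E : Subgroup P} {u : G.graph.V} {w : H.graph.V} {γ : ConjAct P'}
    (hγ : (G.vertGp u).map α.toMulEquiv.toMonoidHom = γ • H.vertGp w) :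
    (∃ δ : ConjAct P, E ≤ δ • G.vertGp u) ↔
      ∃ δ' : ConjAct P', E.map α.toMulEquiv.toMonoidHom ≤ δ' • H.vertGp w := by
  constructor
  · rintro ⟨δ, hδ⟩
    refine ⟨ConjAct.toConjAct (α.toMulEquiv.toMonoidHom (ConjAct.ofConjAct δ)) * γ, ?_⟩
    rw [mul_smul, ← hγ, ← map_conj_smul]
    exact Subgroup.map_mono hδ
  · rintro ⟨δ', hδ'⟩
    have hw : H.vertGp w = γ⁻¹ • (G.vertGp u).map α.toMulEquiv.toMonoidHom := by
      rw [hγ, inv_smul_smul]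
    rw [hw, ← mul_smul, smul_map_eq_map_smul] at hδ'
    exact ⟨_, (Subgroup.map_le_map_iff_of_injective α.injective).mp hδ'⟩

/-- "`E` lies in a verticial subgroup arising from `w`" is a property of the conjugacy class of `E`.
[cite: MochizukiCombGC2007, Prop 1.5(ii) p.13] -/
theorem exists_le_smul_iff_smul {E : Subgroup P'} {w : H.graph.V} (γ : ConjAct P') :
    (∃ δ : ConjAct P', γ • E ≤ δ • H.vertGp w) ↔ ∃ δ : ConjAct P', E ≤ δ • H.vertGp w := by
  constructor
  · rintro ⟨δ, hδ⟩
    exact ⟨γ⁻¹ * δ, by rw [mul_smul]; exact Subgroup.pointwise_smul_subset_iff.mp hδ⟩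
  · rintro ⟨δ, hδ⟩
    exact ⟨γ * δ, by rw [mul_smul]; exact Subgroup.pointwise_smul_le_pointwise_smul_iff.mpr hδ⟩

/-- The vertices abutted by a node `e` all carry verticial subgroups containing `Π_e` (the branch
inclusions of Def. 1.1); under the branch link `hAb` of the proof of Prop. 1.5 (i) these are ALL the
vertices whose verticial subgroups contain `Π_e`. [cite: MochizukiCombGC2007, Prop 1.5(i) p.13] -/
theorem mem_nodeEnds_iff_exists_nodeGp_le_smul (G : PSCDatum P)
    (hAb : ∀ (e : G.graph.N) (u : G.graph.V) (δ : ConjAct P),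
      G.nodeGp e ≤ δ • G.vertGp u → u ∈ G.graph.nodeEnds e)
    (e : G.graph.N) (u : G.graph.V) :
    u ∈ G.graph.nodeEnds e ↔ ∃ δ : ConjAct P, G.nodeGp e ≤ δ • G.vertGp u := by
  refine ⟨fun hu => ?_, fun ⟨δ, hδ⟩ => hAb e u δ hδ⟩
  obtain ⟨v₁, v₂, he, ⟨γ₁, h₁⟩, ⟨γ₂, h₂⟩⟩ := G.nodeGp_le e
  rw [he, Sym2.mem_iff] at hu
  rcases hu with rfl | rfl
  · exact ⟨γ₁⁻¹, Subgroup.pointwise_smul_subset_iff.mp h₁⟩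
  · exact ⟨γ₂⁻¹, Subgroup.pointwise_smul_subset_iff.mp h₂⟩

/-- **The branch link is automatic for nodes with two distinct end vertices** (from Prop. 1.2 (i) and
the COUNTED incidence relation Prop. 1.5 (i) as typed): if `nodeEnds e = {v₁, v₂}` with `v₁ ≠ v₂`, the
two verticial subgroups containing `Π_e` are the evident conjugates of `Π_{v₁}`, `Π_{v₂}`, so any
verticial subgroup `δ Π_u δ⁻¹ ⊇ Π_e` has `u ∈ {v₁, v₂}`.  (For a loop the counted form does not name the
second verticial subgroup; that is the only case in which the branch link carries information.)
[cite: MochizukiCombGC2007, Prop 1.5(i) p.13] -/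
theorem mem_nodeEnds_of_nodeGp_le (hV : G.VerticialOpenInterDeterminesVertex)
    (hE : G.EdgeLikeOpenInterDeterminesEdge) (hInc : G.EdgeLikeIncidence) {e : G.graph.N}
    (hne : ¬ (G.graph.nodeEnds e).IsDiag) {u : G.graph.V} {δ : ConjAct P}
    (h : G.nodeGp e ≤ δ • G.vertGp u) : u ∈ G.graph.nodeEnds e := by
  obtain ⟨v₁, v₂, he, ⟨γ₁, h₁⟩, ⟨γ₂, h₂⟩⟩ := G.nodeGp_le e
  rw [he] at hne ⊢
  rw [Sym2.mk_isDiag_iff] at hne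
  have hnod : G.IsNodal (G.nodeGp e) := ⟨e, 1, (one_smul _ _).symm⟩
  have hnc : ¬ G.IsCuspidal (G.nodeGp e) := not_isCuspidal_of_isNodal hE hnod
  obtain ⟨B₁, B₂, -, hall⟩ := ((hInc _ (Or.inl hnod)).2).mp hnc
  have hA₁ := (hall (γ₁⁻¹ • G.vertGp v₁)).mp
    ⟨⟨v₁, γ₁⁻¹, rfl⟩, Subgroup.pointwise_smul_subset_iff.mp h₁⟩
  have hA₂ := (hall (γ₂⁻¹ • G.vertGp v₂)).mp
    ⟨⟨v₂, γ₂⁻¹, rfl⟩, Subgroup.pointwise_smul_subset_iff.mp h₂⟩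
  have hAu := (hall (δ • G.vertGp u)).mp ⟨⟨u, δ, rfl⟩, h⟩
  have h12 : γ₁⁻¹ • G.vertGp v₁ ≠ γ₂⁻¹ • G.vertGp v₂ :=
    fun heq => hne (eq_of_smul_vertGp_eq hV heq)
  rw [Sym2.mem_iff]
  by_cases hu₁ : δ • G.vertGp u = γ₁⁻¹ • G.vertGp v₁
  · exact Or.inl (eq_of_smul_vertGp_eq hV hu₁)
  by_cases hu₂ : δ • G.vertGp u = γ₂⁻¹ • G.vertGp v₂
  · exact Or.inr (eq_of_smul_vertGp_eq hV hu₂)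
  exfalso
  rcases hAu with hX | hX <;> rcases hA₁ with h1 | h1 <;> rcases hA₂ with h2 | h2 <;>
    first
    | exact hu₁ (hX.trans h1.symm)
    | exact hu₂ (hX.trans h2.symm)
    | exact h12 (h1.trans h2.symm)

/-- Hence the branch link for ALL nodes follows from its LOOP case ("`Π_e ≤ δ Π_u δ⁻¹ ⇒ u = v`" for a
loop `e` at `v`) together with Prop. 1.2 (i) and the counted Prop. 1.5 (i).
[cite: MochizukiCombGC2007, Prop 1.5(i) p.13] -/
theorem abutment_of_loops (hV : G.VerticialOpenInterDeterminesVertex)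
    (hE : G.EdgeLikeOpenInterDeterminesEdge) (hInc : G.EdgeLikeIncidence)
    (hloop : ∀ (e : G.graph.N) (v : G.graph.V), G.graph.nodeEnds e = s(v, v) →
      ∀ (u : G.graph.V) (δ : ConjAct P), G.nodeGp e ≤ δ • G.vertGp u → u = v)
    (e : G.graph.N) (u : G.graph.V) (δ : ConjAct P) (h : G.nodeGp e ≤ δ • G.vertGp u) :
    u ∈ G.graph.nodeEnds e := by
  by_cases hd : (G.graph.nodeEnds e).IsDiag
  · obtain ⟨v₁, v₂, he, -, -⟩ := G.nodeGp_le e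
    rw [he, Sym2.mk_isDiag_iff] at hd
    subst hd
    rw [he, Sym2.mem_iff]
    exact Or.inl (hloop e v₁ he u δ h)
  · exact mem_nodeEnds_of_nodeGp_le hV hE hInc hd h

end Abutment

end PSCDatum

end Literature.AnabelianGeometry.SemiGraphs

end
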